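import Mathlib
import Literature.AlgebraicGeometry.Resolution.CobordantGame
import Literature.AlgebraicGeometry.Resolution.CobordantChartCoefficients
import Literature.AlgebraicGeometry.Resolution.AxisPolyhedron
import Summits.ResolutionOfSingularities.ResolutionOfSingularities.Theorems.WeightedInvariantLocalWeightedDropTangentConeCut
import Summits.ResolutionOfSingularities.ResolutionOfSingularities.Theorems.WeightedInvariantLocalWeightedDropApexFreeOrderDrop

/-!
# `WeightedInvariant.LocalWeightedDrop`, line `hasse-ridge-face-selection`: the axis move (B4)

Crux item stmt-ResolutionOfSingularities-8899 (route `ResolutionOfSingularities/WeightedInvariant`),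
skeleton v18 of the line `hasse-ridge-face-selection`, stub `stub_axisMove`, PROVED here
(statement verbatim from the ledger registration).

**Statement (blowing up an equimultiple axis).**  Let `g ∈ k[[x'₁, …, x'ₙ, z]]` (`z = Fin.last n`,
`x'_j = Fin.castSucc j`) be singular of order `d`, with `g ∈ (x')^d` (`AxisPolyhedron.InAxisIdeal`: every
monomial of `g` has `x'`-degree `≥ d`, so the degree-`d` form `F` of `g` is a form in `x'` alone) and with
trivial apex inside `z = 0` (`AxisPolyhedron.TrivialApexX`: no non-zero `(u, 0)` leaves `F` translation
invariant).  If every singular germ in `n + 1` variables of order `< d` is won, then `g` is won.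

**Proof.**  Play the AXIS MOVE: `θ = X`, weights `w = (1, …, 1, 0)` (legal for `n ≥ 1`; `n = 0` is
excluded since then every exponent has `x'`-degree `0 < d` and `g = 0`).  At a singular successor `G`
(exceptional point `c` off the vertex, so `c'_{j₀} ≠ 0` for an `x'`-slot `j₀`; by the crux's convention the
chart is `CobordantChart.chart w c♭` with `c♭ = (c', 0)`, `z ↦ y_z`), the `w`-weight of an exponent is its
`x'`-degree, so the `w`-order of `g` is `d` and `g(chart) = s^d · G`
(`CobordantChart.eq_weightedOrder_of_factor`).  By the coefficient formula
(`CobordantChart.coeff_subst_chart`) the coefficient `s⁰ y'^β y_z⁰` of `G` is the `y^β`-coefficient of the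
TRANSLATE `∑_{|e| = d} g_e ∏ᵢ (c♭ᵢ + yᵢ)^{eᵢ}` (exponents with `e_z > 0` are killed by the factor
`0^{e_z}`).  If the tame slice `S = G|_{y'_{j₀} = 0}` had order `≥ d`, then so would `G = u · Φ(cyl S)`
(`tameSlice`; substitutions without constant terms and units do not lower the order), all those
coefficients with `|β| < d` would vanish, and together with `g ∈ (x')^d` (which kills the `y_z`-monomials of
the translate of low degree) and the binomial vanishing in degrees `≥ d`
(`ApexFreeOrderDrop.sum_translate_eq_of_le`) the translate would BE the form: evaluating,
`F(v + c♭) = F(v)` for all `v`, against the trivial apex at `u = c' ≠ 0`.  So `ord S < d = ord g`, `S` is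
won (by hypothesis if singular, outright if not), and `G = u · Φ(cyl S)` is won with it
(`won_cyl`, `won_subst_iff`, `won_unit_mul_iff`) — exactly as in `TangentConeCut.apexFreeStartsWon`.
-/

set_option linter.dupNamespace false -- mandated namespace of this single-conjunct summit

namespace Summit.ResolutionOfSingularities.ResolutionOfSingularities.Theorems

open Literature.AlgebraicGeometry.Resolution

namespace AxisMove

variable {k : Type} [Field k] {n : ℕ}

/-! ### Axis weights `(1, …, 1, 0)`: the weight of an exponent is its `x'`-degree -/

/-- The total degree of an exponent of `k[[x', z]]` is its `x'`-degree plus its `z`-exponent. -/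
theorem degree_eq_xDeg_add (E : Fin (n + 1) →₀ ℕ) :
    E.degree = AxisPolyhedron.xDeg E + E (Fin.last n) := by
  rw [Finsupp.degree_eq_sum, Fin.sum_univ_castSucc]
  rfl

/-- For the axis weights (`1` on the `x'_j`, `0` on `z`) the weight of an exponent is its `x'`-degree. -/
theorem weight_eq_xDeg {w : Fin (n + 1) → ℕ} (hw0 : w (Fin.last n) = 0)
    (hw1 : ∀ j, w (Fin.castSucc j) = 1) (E : Fin (n + 1) →₀ ℕ) :
    Finsupp.weight w E = AxisPolyhedron.xDeg E := by
  rw [Finsupp.weight_apply, Finsupp.sum_fintype _ _ (fun i => by simp), Fin.sum_univ_castSucc, hw0]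
  simp only [hw1, smul_eq_mul, mul_one, mul_zero, add_zero]
  rfl

/-- The axis weights satisfy the crux's chart convention (`w_i = 0 → c_i = 0`) at every point `c`
with `c_z = 0`. -/
theorem convention {w : Fin (n + 1) → ℕ} (hw1 : ∀ j, w (Fin.castSucc j) = 1) {c : Fin (n + 1) → k}
    (hc : c (Fin.last n) = 0) : ∀ i, w i = 0 → c i = 0 := by
  intro i hi
  rcases Fin.eq_castSucc_or_eq_last i with ⟨j, rfl⟩ | rfl
  · rw [hw1] at hi
    exact absurd hi one_ne_zero
  · exact hc

/-- For `g ∈ (x')^d` of order `d` (and `g ≠ 0`), the axis-weighted order of `g` is `d`. -/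
theorem weightedOrder_eq {w : Fin (n + 1) → ℕ} (hw0 : w (Fin.last n) = 0)
    (hw1 : ∀ j, w (Fin.castSucc j) = 1) {d : ℕ} {g : MvPowerSeries (Fin (n + 1)) k}
    (hin : AxisPolyhedron.InAxisIdeal d g) (hgd : g.order = d) (hg : g ≠ 0) :
    g.weightedOrder w = d := by
  apply le_antisymm
  · obtain ⟨E, hE, hEd⟩ := MvPowerSeries.exists_coeff_ne_zero_and_order
      ((MvPowerSeries.ne_zero_iff_order_finite).mp hg)
    rw [hgd, Nat.cast_inj] at hEd
    refine (MvPowerSeries.weightedOrder_le w hE).trans ?_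
    rw [weight_eq_xDeg hw0 hw1, Nat.cast_le, ← hEd, degree_eq_xDeg_add]
    exact Nat.le_add_right _ _
  · exact MvPowerSeries.nat_le_weightedOrder w fun E hE =>
      hin E (by rwa [weight_eq_xDeg hw0 hw1] at hE)

/-- The degree of an exponent `(0, β)` is that of `β`. -/
theorem degree_cons_zero {m : ℕ} (β : Fin m →₀ ℕ) :
    (Finsupp.cons 0 β : Fin (m + 1) →₀ ℕ).degree = β.degree := by
  rw [Finsupp.degree_eq_sum, Finsupp.degree_eq_sum, Fin.sum_univ_succ, Finsupp.cons_zero, zero_add]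
  simp only [Finsupp.cons_succ]

/-! ### The `s⁰ y_z⁰`-part of the successor is the translated form -/

/-- With `c_z = 0` and `β_z = 0`, an exponent with a positive `z`-component has the vanishing Taylor
factor `C(E_z, 0) · 0^{E_z} = 0`. -/
theorem prod_eq_zero_of_last {c : Fin (n + 1) → k} (hc : c (Fin.last n) = 0)
    {E β : Fin (n + 1) →₀ ℕ} (hβ : β (Fin.last n) = 0) (hE : E (Fin.last n) ≠ 0) :
    ∏ i, (((E i).choose (β i) : k) * c i ^ (E i - β i)) = 0 := by
  refine Finset.prod_eq_zero (Finset.mem_univ (Fin.last n)) ?_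
  rw [hβ, hc, Nat.sub_zero, zero_pow hE, mul_zero]

/-- THE PURE-`y'` COEFFICIENTS OF THE SUCCESSOR: if `g(chart w c) = s^d · G` for the axis weights at a
point `c` with `c_z = 0`, then for `β_z = 0` the coefficient `s⁰ y^β` of `G` is the `y^β`-coefficient of
the translate `∑_{|e| = d} g_e ∏ᵢ (cᵢ + yᵢ)^{eᵢ}` (`CobordantChart.coeff_subst_chart`; the exponents of
`w`-weight `d` with `e_z > 0` and the exponents of degree `d` with `e_z > 0` both carry the factor
`0^{e_z} = 0`). -/
theorem coeff_cons_zero_eq_coeff_translate {w : Fin (n + 1) → ℕ} (hw0 : w (Fin.last n) = 0)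
    (hw1 : ∀ j, w (Fin.castSucc j) = 1) {c : Fin (n + 1) → k} (hc : c (Fin.last n) = 0) {d : ℕ}
    {g : MvPowerSeries (Fin (n + 1)) k} {G : MvPowerSeries (Fin (n + 2)) k}
    (hfac : MvPowerSeries.subst (CobordantChart.chart w c) g = MvPowerSeries.X 0 ^ d * G)
    {β : Fin (n + 1) →₀ ℕ} (hβ : β (Fin.last n) = 0) :
    MvPowerSeries.coeff (Finsupp.cons 0 β) G =
      MvPolynomial.coeff β (∑ e ∈ (Finset.univ : Finset (Fin (n + 1))).finsuppAntidiag d,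
        MvPolynomial.C (MvPowerSeries.coeff e g) *
          ∏ i, (MvPolynomial.C (c i) + MvPolynomial.X i) ^ (e i)) := by
  rw [CobordantChart.coeff_cons_of_eq_X_pow_mul hfac, add_zero,
    CobordantChart.coeff_subst_chart w c (convention hw1 hc) g d β, ApexFreeOrderDrop.coeff_translate,
    ← ApexFreeOrderDrop.finsum_ite_weight_eq]
  refine finsum_congr fun E => ?_
  by_cases hE : E (Fin.last n) = 0
  · rw [weight_eq_xDeg hw0 hw1, ApexFreeOrderDrop.weight_one_eq_degree, degree_eq_xDeg_add, hE,
      add_zero]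
  · rw [prod_eq_zero_of_last hc hβ hE, mul_zero]
    split_ifs <;> rfl

/-- THE TRANSLATED FORM IS THE FORM when the pure-`y'` part of the successor has order `≥ d`: for
`g ∈ (x')^d` and `c_z = 0`, if every coefficient `s⁰ y'^β y_z⁰` of `G` with `|β| < d` vanishes, then
`∑_{|e| = d} g_e ∏ᵢ (cᵢ + yᵢ)^{eᵢ} = ∑_{|e| = d} g_e y^e` as polynomials (low degree without `y_z`: the
hypothesis; low degree with `y_z`: binomial vanishing or `g ∈ (x')^d`; degree `≥ d`:
`ApexFreeOrderDrop.sum_translate_eq_of_le`). -/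
theorem translate_eq_initForm {w : Fin (n + 1) → ℕ} (hw0 : w (Fin.last n) = 0)
    (hw1 : ∀ j, w (Fin.castSucc j) = 1) {c : Fin (n + 1) → k} (hc : c (Fin.last n) = 0) {d : ℕ}
    {g : MvPowerSeries (Fin (n + 1)) k} (hin : AxisPolyhedron.InAxisIdeal d g)
    {G : MvPowerSeries (Fin (n + 2)) k}
    (hfac : MvPowerSeries.subst (CobordantChart.chart w c) g = MvPowerSeries.X 0 ^ d * G)
    (hG : ∀ β : Fin (n + 1) →₀ ℕ, β (Fin.last n) = 0 → β.degree < d →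
      MvPowerSeries.coeff (Finsupp.cons 0 β) G = 0) :
    (∑ e ∈ (Finset.univ : Finset (Fin (n + 1))).finsuppAntidiag d,
        MvPolynomial.C (MvPowerSeries.coeff e g) *
          ∏ i, (MvPolynomial.C (c i) + MvPolynomial.X i) ^ (e i)) =
      ∑ e ∈ (Finset.univ : Finset (Fin (n + 1))).finsuppAntidiag d,
        MvPolynomial.monomial e (MvPowerSeries.coeff e g) := by
  refine MvPolynomial.ext _ _ fun β => ?_
  rw [ApexFreeOrderDrop.coeff_initForm]
  by_cases hβd : β.degree < d
  · rw [if_neg (fun hmem => by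
      rw [ApexFreeOrderDrop.mem_antidiag_iff, ApexFreeOrderDrop.weight_one_eq_degree] at hmem
      omega)]
    by_cases hβl : β (Fin.last n) = 0
    · -- a pure-`y'` coefficient of `G` of low degree
      rw [← coeff_cons_zero_eq_coeff_translate hw0 hw1 hc hfac hβl, hG β hβl hβd]
    · -- a monomial with `y_z`: binomial vanishing or `g ∈ (x')^d`
      rw [ApexFreeOrderDrop.coeff_translate]
      refine Finset.sum_eq_zero fun E hE => ?_
      by_cases hEl : E (Fin.last n) < β (Fin.last n)
      · rw [Finset.prod_eq_zero (Finset.mem_univ (Fin.last n))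
          (by rw [Nat.choose_eq_zero_of_lt hEl, Nat.cast_zero, zero_mul]), mul_zero]
      · have hEd : E.degree = d := by
          rw [← ApexFreeOrderDrop.weight_one_eq_degree]
          exact (ApexFreeOrderDrop.mem_antidiag_iff d E).mp hE
        rw [degree_eq_xDeg_add] at hEd
        rw [hin E (by omega), zero_mul]
  · push Not at hβd
    rw [ApexFreeOrderDrop.coeff_translate, ApexFreeOrderDrop.sum_translate_eq_of_le g c hβd]
    by_cases hw : Finsupp.weight (fun _ : Fin (n + 1) => 1) β = d
    · rw [if_pos hw, if_pos ((ApexFreeOrderDrop.mem_antidiag_iff d β).mpr hw)]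
    · rw [if_neg hw, if_neg (fun h => hw ((ApexFreeOrderDrop.mem_antidiag_iff d β).mp h))]

/-- … HENCE `c` IS A TRANSLATION-INVARIANCE VECTOR of the degree-`d` form of `g`:
`in_d g (V + c) = in_d g (V)` for all `V` (evaluate both polynomials at `V`). -/
theorem initEval_add_eq {w : Fin (n + 1) → ℕ} (hw0 : w (Fin.last n) = 0)
    (hw1 : ∀ j, w (Fin.castSucc j) = 1) {c : Fin (n + 1) → k} (hc : c (Fin.last n) = 0) {d : ℕ}
    {g : MvPowerSeries (Fin (n + 1)) k} (hin : AxisPolyhedron.InAxisIdeal d g)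
    {G : MvPowerSeries (Fin (n + 2)) k}
    (hfac : MvPowerSeries.subst (CobordantChart.chart w c) g = MvPowerSeries.X 0 ^ d * G)
    (hG : ∀ β : Fin (n + 1) →₀ ℕ, β (Fin.last n) = 0 → β.degree < d →
      MvPowerSeries.coeff (Finsupp.cons 0 β) G = 0)
    (V : Fin (n + 1) → k) :
    CobordantChart.initEval (fun _ : Fin (n + 1) => 1) (V + c) d g =
      CobordantChart.initEval (fun _ : Fin (n + 1) => 1) V d g := by
  rw [← ApexFreeOrderDrop.eval_translate c V d g, translate_eq_initForm hw0 hw1 hc hin hfac hG,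
    ApexFreeOrderDrop.eval_initForm]

end AxisMove

open AxisMove ApexFreeOrderDrop in
/-- THE AXIS MOVE, stub `stub_axisMove` (B4) of the line `hasse-ridge-face-selection` of crux
`LocalWeightedDrop` (stmt-ResolutionOfSingularities-8899): a singular `g` of order `d` with `g ∈ (x')^d`
(`InAxisIdeal`, equimultiple along the `z`-axis) and trivial apex inside `z = 0` (`TrivialApexX`) is won,
given the singular germs of smaller order: blow up the axis (`θ = X`, weights `(1, …, 1, 0)`); at an
exceptional point (`c' ≠ 0`, `c_z = 0` by convention) the pure-`y'` part of the successor is the translate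
`F(c' + y')` of the degree-`d` form, of order `< d` by the trivial apex, so the tame slice (weight `1`) has
order `< d` and is won, and the successor `u · Φ(cyl S)` with it. -/
theorem stub_axisMove : ∀ (p : ℕ), p.Prime → ∀ (k : Type) [Field k] [CharP k p] (n d : ℕ)
    (g : MvPowerSeries (Fin (n + 1)) k), CobordantGame.IsSingular k g → g.order = d →
    AxisPolyhedron.InAxisIdeal d g → AxisPolyhedron.TrivialApexX d g →
    (∀ h : MvPowerSeries (Fin (n + 1)) k, CobordantGame.IsSingular k h → h.order < g.order →
      CobordantGame.Won k (n + 1) h) →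
    CobordantGame.Won k (n + 1) g := by
  intro p hp k _ _ n d g hg hgd hin hapex hord
  -- `d ≥ 2`, and `n ≥ 1`: otherwise every exponent has `x'`-degree `0 < d` and `g = 0`
  have hd2 : 2 ≤ d := by
    have h := (FormalCoordChange.two_le_order_iff g).mpr hg.2
    rw [hgd] at h
    exact_mod_cast h
  rcases Nat.eq_zero_or_pos n with hn | hn
  · subst hn
    obtain ⟨E, hE, -⟩ := MvPowerSeries.exists_coeff_ne_zero_and_order
      ((MvPowerSeries.ne_zero_iff_order_finite).mp hg.1)
    refine absurd (hin E ?_) hE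
    change ∑ j : Fin 0, E (Fin.castSucc j) < d
    rw [Finset.univ_eq_empty, Finset.sum_empty]
    omega
  -- the axis weights `(1, …, 1, 0)`
  set w : Fin (n + 1) → ℕ := fun i => if i = Fin.last n then 0 else 1 with hw
  have hw0 : w (Fin.last n) = 0 := if_pos rfl
  have hw1 : ∀ j, w (Fin.castSucc j) = 1 := fun j => if_neg (Fin.castSucc_ne_last j)
  -- THE MOVE `(X, w)`
  have hmove : CobordantGame.IsMove k
      (MvPowerSeries.X : Fin (n + 1) → MvPowerSeries (Fin (n + 1)) k) w :=
    ⟨fun i => MvPowerSeries.constantCoeff_X i, (TangentConeCut.isMove_X_one (Nat.succ_pos n)).2.1,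
      ⟨Fin.castSucc ⟨0, hn⟩, by rw [hw1]; exact one_pos⟩⟩
  refine CobordantGame.Won.move MvPowerSeries.X w hmove fun G hG => ?_
  obtain ⟨c, a, ⟨i₀, hwi₀, hci₀⟩, hfac, hndvd, -⟩ := hG
  -- the crux's chart is `chart w c♭` with `c♭ = (c', 0)`, and `subst X g = g`
  set cf : Fin (n + 1) → k := fun i => if 0 < w i then c i else 0 with hcf
  have hchart : CobordantGame.cruxChart k w c = CobordantChart.chart w cf :=
    CobordantChart.cruxChart_eq_chart w c
  have hself : MvPowerSeries.subst (MvPowerSeries.X : Fin (n + 1) → MvPowerSeries (Fin (n + 1)) k) g = g := by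
    rw [MvPowerSeries.subst_self]; rfl
  rw [hchart, hself] at hfac
  have hcfz : cf (Fin.last n) = 0 := by simp [hcf, hw0]
  have hconv : ∀ i, w i = 0 → cf i = 0 := convention hw1 hcfz
  -- the off-vertex slot is an `x'`-slot `j₀`
  have hi₀ : i₀ ≠ Fin.last n := fun h => by
    rw [h, hw0] at hwi₀
    exact lt_irrefl 0 hwi₀
  obtain ⟨j₀, rfl⟩ := Fin.exists_castSucc_eq.mpr hi₀
  have hcfj₀ : cf (Fin.castSucc j₀) ≠ 0 := by simpa [hcf, hw1] using hci₀
  -- `a = d`: the `w`-order of `g ∈ (x')^d` is `d`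
  have had : a = d := by
    have h : (a : ℕ∞) = g.weightedOrder w :=
      CobordantChart.eq_weightedOrder_of_factor w cf hconv hg.1 hfac hndvd
    rw [weightedOrder_eq hw0 hw1 hin hgd hg.1] at h
    exact_mod_cast h
  rw [had] at hfac
  -- tame slice at the slot `j₀` (weight `1`, never divisible by `p`)
  have hp1 : ¬ p ∣ w (Fin.castSucc j₀) := by
    rw [hw1]
    exact fun h => hp.one_lt.ne' (Nat.dvd_one.mp h)
  obtain ⟨Φ, u, hΦ0, hΦdet, hu, hGu⟩ :=
    tameSlice p hp k (n + 1) g w cf hconv d G hfac (Fin.castSucc j₀) hcfj₀ hp1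
  set S : MvPowerSeries (Fin (n + 1)) k := MvPowerSeries.subst
    (fun l : Fin (n + 2) => if l = (Fin.castSucc j₀).succ then (0 : MvPowerSeries (Fin (n + 1)) k)
      else MvPowerSeries.X (Fin.predAbove (Fin.castSucc j₀) l)) G with hS
  -- THE ORDER DROPS: otherwise `c♭ = (c', 0)` is a translation-invariance vector inside `z = 0`
  have hSlt : S.order < (d : ℕ∞) := by
    by_contra hge
    push Not at hge
    have hGord : (d : ℕ∞) ≤ G.order := by
      rw [hGu]
      refine le_trans ?_ MvPowerSeries.le_order_mul
      refine le_trans ?_ le_add_self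
      refine le_trans ?_ (order_le_order_subst hΦ0 _)
      exact le_trans hge (order_le_order_subst (fun m => MvPowerSeries.constantCoeff_X _) _)
    have hGβ : ∀ β : Fin (n + 1) →₀ ℕ, β (Fin.last n) = 0 → β.degree < d →
        MvPowerSeries.coeff (Finsupp.cons 0 β) G = 0 := fun β _ hβd =>
      MvPowerSeries.coeff_of_lt_order
        (lt_of_lt_of_le (by rw [degree_cons_zero]; exact_mod_cast hβd) hGord)
    -- `u := c' ≠ 0` and `c♭ = (u, 0)`
    have hu0 : (fun j : Fin n => cf (Fin.castSucc j)) ≠ 0 := fun h => hcfj₀ (congrFun h j₀)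
    have hsnoc : (Fin.snoc (fun j : Fin n => cf (Fin.castSucc j)) 0 : Fin (n + 1) → k) = cf := by
      funext l
      refine Fin.lastCases ?_ (fun j => ?_) l
      · rw [Fin.snoc_last, hcfz]
      · rw [Fin.snoc_castSucc]
    obtain ⟨v, hv⟩ := hapex _ hu0
    rw [hsnoc] at hv
    exact hv (initEval_add_eq hw0 hw1 hcfz hin hfac hGβ _)
  -- so the slice is won …
  have hWS : CobordantGame.Won k (n + 1) S := by
    by_cases hSs : CobordantGame.IsSingular k S
    · exact hord S hSs (hgd ▸ hSlt)
    · exact (wonBy_zero_of_not_isSingular (Nat.succ_pos n) hSs).won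
  -- … and with it the successor `G = u · Φ(cyl S)`
  rw [hGu]
  exact (won_unit_mul_iff hu _).mpr ((won_subst_iff hΦ0 hΦdet _).mpr
    (won_cyl (Fin.castSucc j₀).succ hWS))

end Summit.ResolutionOfSingularities.ResolutionOfSingularities.Theorems
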